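import Mathlib.Analysis.SpecialFunctions.SmoothTransition
import Mathlib.Analysis.Calculus.IteratedDeriv.Lemmas
import Mathlib.Analysis.Calculus.Deriv.Support
import Mathlib.Analysis.Calculus.LocalExtr.Basic
import Mathlib.Analysis.Normed.Group.Bounded
import HarnessLib

/-!
# The BDSV gluing stage: the time cut-offs of §4.1

Buckmaster–De Lellis–Székelyhidi–Vicol, *Onsager's conjecture for admissible weak solutions*,
CPAM 72 (2019) = arXiv:1701.08678, §4.1, glue the exact solutions `vᵢ` with "a partition of
unity `{χᵢ}` in time" such that `∑ χᵢ ≡ 1`, `supp χᵢ ∩ supp χᵢ₊₂ = ∅`,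
`supp χᵢ ⊂ (tᵢ - 2τ_q/3, tᵢ + 2τ_q/3)`, `χᵢ = 1` on `Jᵢ = (tᵢ - τ_q/3, tᵢ + τ_q/3)`, and
`‖∂ₜ^N χᵢ‖₀ ≲ τ_q^{-N}` ((4.1)–(4.3) of the arXiv version; the paper does not fix a formula). This
file constructs such cut-offs from one smooth **step profile** `η` (`BDSV.stepProfile`,
`η = 1` on `(-∞, 1/3]`, `η = 0` on `[2/3, ∞)`, values in `[0,1]`, built on Mathlib's
`Real.smoothTransition`) through the **steps** `θ(t) = η((t - t₀)/τ)` (`BDSV.glueStep τ t₀`: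
`= 1` for `t ≤ t₀ + τ/3`, `= 0` for `t ≥ t₀ + 2τ/3`); the partition of unity of §4.1 is then
`χ₀ = θ_{t₀}`, `χᵢ = θ_{tᵢ} - θ_{tᵢ₋₁}` (and on `Iᵢ`, `χᵢ = θ_{tᵢ}`, `χᵢ₊₁ = 1 - θ_{tᵢ}`), which is how
the glued triple is written in the construction file. Proved here:

* `BDSV.stepProfile`: smoothness, the plateaus, `0 ≤ η ≤ 1`, vanishing of `η'` off
  `(1/3, 2/3)` (Fermat), compact support of `η'`, and uniform bounds
  `‖η^{(N)}‖_∞ ≤ E_N` (`BDSV.stepProfileBound N`, by continuity and compact support);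
* `BDSV.glueStep τ t₀`: smoothness, plateaus, `0 ≤ θ ≤ 1`, `θ' = 0` and `θ(1-θ) = 0` off
  `(t₀ + τ/3, t₀ + 2τ/3)`, the chain rule `θ^{(N)}(t) = τ^{-N} η^{(N)}((t - t₀)/τ)` and the bound
  (4.3) `|θ^{(N)}(t)| ≤ E_N τ^{-N}`.

Pure one-variable calculus; nothing here refers to the torus.

## References

* T. Buckmaster, C. De Lellis, L. Székelyhidi Jr., V. Vicol, *Onsager's conjecture for admissible
  weak solutions*, Comm. Pure Appl. Math. 72 (2019) 229–274 = arXiv:1701.08678, §4.1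
  (partition of unity, (4.1)–(4.3)).
-/

open Set Filter Topology

noncomputable section

namespace Literature.Analysis.FluidPDE

namespace BDSV

/-! ## The step profile `η` -/

section Profile

/-- The smooth **step profile** `η(s) = smoothTransition(2 - 3s)`: `η = 1` for `s ≤ 1/3`, `η = 0`
for `s ≥ 2/3`, `0 ≤ η ≤ 1` (a concrete choice for the time cut-offs of BDSV §4.1, which the paper
leaves unspecified). [cite: BuckmasterEtAl2018, §4.1 (4.1)–(4.3)] -/
def stepProfile (s : ℝ) : ℝ :=
  Real.smoothTransition (2 - 3 * s)

/-- `η` is smooth. [folklore] -/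
theorem contDiff_stepProfile {n : ℕ∞} : ContDiff ℝ n stepProfile :=
  Real.smoothTransition.contDiff.comp (contDiff_const.sub (contDiff_const.mul contDiff_id))

/-- `η s = 1` for `s ≤ 1/3`. [folklore] -/
theorem stepProfile_of_le {s : ℝ} (hs : s ≤ 1 / 3) : stepProfile s = 1 :=
  Real.smoothTransition.one_of_one_le (by linarith)

/-- `η s = 0` for `s ≥ 2/3`. [folklore] -/
theorem stepProfile_of_ge {s : ℝ} (hs : 2 / 3 ≤ s) : stepProfile s = 0 :=
  Real.smoothTransition.zero_of_nonpos (by linarith)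

/-- `0 ≤ η ≤ 1`. [folklore] -/
theorem stepProfile_mem_Icc (s : ℝ) : stepProfile s ∈ Icc (0 : ℝ) 1 :=
  ⟨Real.smoothTransition.nonneg _, Real.smoothTransition.le_one _⟩

/-- `η' s = 0` for `s ≤ 1/3` and for `s ≥ 2/3`: there `η` attains its maximum `1`, resp. its minimum
`0` (Fermat). [folklore] -/
theorem deriv_stepProfile_eq_zero {s : ℝ} (hs : s ≤ 1 / 3 ∨ 2 / 3 ≤ s) : deriv stepProfile s = 0 := by
  rcases hs with hs | hs
  · refine IsLocalMax.deriv_eq_zero ?_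
    filter_upwards with u
    rw [stepProfile_of_le hs]
    exact (stepProfile_mem_Icc u).2
  · refine IsLocalMin.deriv_eq_zero ?_
    filter_upwards with u
    rw [stepProfile_of_ge hs]
    exact (stepProfile_mem_Icc u).1

/-- `η'` is supported in `[1/3, 2/3]`, hence compactly supported. [folklore] -/
theorem hasCompactSupport_deriv_stepProfile : HasCompactSupport (deriv stepProfile) := by
  refine HasCompactSupport.of_support_subset_isCompact (isCompact_Icc (a := (1 / 3 : ℝ)) (b := 2 / 3)) ?_
  intro s hs
  by_contra h
  rw [mem_Icc, not_and_or, not_le, not_le] at h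
  exact hs (deriv_stepProfile_eq_zero (h.imp le_of_lt le_of_lt))

/-- The derivatives `η^{(N)}`, `N ≥ 1`, are compactly supported. [folklore] -/
theorem hasCompactSupport_iteratedDeriv_stepProfile {N : ℕ} (hN : 1 ≤ N) :
    HasCompactSupport (iteratedDeriv N stepProfile) := by
  obtain ⟨m, rfl⟩ := Nat.exists_eq_add_of_le' hN
  induction m with
  | zero => simpa using hasCompactSupport_deriv_stepProfile
  | succ m ih =>
    rw [iteratedDeriv_succ]
    exact (ih (Nat.le_add_left 1 m)).deriv

/-- Every derivative of `η` is bounded: `‖η^{(N)}‖_∞ < ∞` (`|η| ≤ 1`; for `N ≥ 1`, `η^{(N)}` is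
continuous with compact support). [folklore] -/
theorem exists_bound_iteratedDeriv_stepProfile (N : ℕ) :
    ∃ E : ℝ, 0 ≤ E ∧ ∀ s, ‖iteratedDeriv N stepProfile s‖ ≤ E := by
  rcases Nat.eq_zero_or_pos N with rfl | hN
  · refine ⟨1, zero_le_one, fun s => ?_⟩
    rw [iteratedDeriv_zero, Real.norm_eq_abs, abs_le]
    exact ⟨by linarith [(stepProfile_mem_Icc s).1], (stepProfile_mem_Icc s).2⟩
  · have hc : Continuous (iteratedDeriv N stepProfile) :=
      contDiff_stepProfile.continuous_iteratedDeriv N (by exact_mod_cast le_top)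
    obtain ⟨E, hE⟩ := hc.bounded_above_of_compact_support (hasCompactSupport_iteratedDeriv_stepProfile hN)
    exact ⟨max E 0, le_max_right _ _, fun s => (hE s).trans (le_max_left _ _)⟩

/-- A bound `E_N` for `‖η^{(N)}‖_∞` (the constants of (4.3)). [folklore] -/
def stepProfileBound (N : ℕ) : ℝ :=
  Classical.choose (exists_bound_iteratedDeriv_stepProfile N)

/-- `0 ≤ E_N`. [folklore] -/
theorem stepProfileBound_nonneg (N : ℕ) : 0 ≤ stepProfileBound N :=
  (Classical.choose_spec (exists_bound_iteratedDeriv_stepProfile N)).1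

/-- `|η^{(N)}(s)| ≤ E_N`. [folklore] -/
theorem norm_iteratedDeriv_stepProfile_le (N : ℕ) (s : ℝ) :
    ‖iteratedDeriv N stepProfile s‖ ≤ stepProfileBound N :=
  (Classical.choose_spec (exists_bound_iteratedDeriv_stepProfile N)).2 s

/-- In particular `E₀ ≥ 1 > 0` is not needed, but `|η(s)| ≤ E₀`. [folklore] -/
theorem abs_stepProfile_le (s : ℝ) : |stepProfile s| ≤ stepProfileBound 0 := by
  simpa [iteratedDeriv_zero, Real.norm_eq_abs] using norm_iteratedDeriv_stepProfile_le 0 s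

end Profile

/-! ## The steps `θ(t) = η((t - t₀)/τ)` -/

section Step

variable {τ t₀ t : ℝ}

/-- The smooth **step** anchored at `t₀` with scale `τ`: `θ(t) = η(τ⁻¹(t - t₀))`, equal to `1`
for `t ≤ t₀ + τ/3` and to `0` for `t ≥ t₀ + 2τ/3` (`τ > 0`). With `t₀ = tᵢ = iτ_q` these generate
the partition of unity of BDSV §4.1: `χ₀ = θ_{t₀}`, `χᵢ = θ_{tᵢ} - θ_{tᵢ₋₁}`; on
`Iᵢ = [tᵢ + τ_q/3, tᵢ + 2τ_q/3]`, `χᵢ = θ_{tᵢ}` and `χᵢ₊₁ = 1 - θ_{tᵢ}`.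
[cite: BuckmasterEtAl2018, §4.1 (4.1)–(4.3)] -/
def glueStep (τ t₀ : ℝ) (t : ℝ) : ℝ :=
  stepProfile (τ⁻¹ * (t - t₀))

/-- `θ` is smooth. [folklore] -/
theorem contDiff_glueStep {n : ℕ∞} (τ t₀ : ℝ) : ContDiff ℝ n (glueStep τ t₀) :=
  contDiff_stepProfile.comp (contDiff_const.mul (contDiff_id.sub contDiff_const))

/-- `θ t = 1` for `t ≤ t₀ + τ/3` (`τ > 0`). [folklore] -/
theorem glueStep_of_le (hτ : 0 < τ) (ht : t ≤ t₀ + τ / 3) : glueStep τ t₀ t = 1 := by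
  refine stepProfile_of_le ?_
  rw [inv_mul_le_iff₀ hτ]
  linarith

/-- `θ t = 0` for `t ≥ t₀ + 2τ/3` (`τ > 0`). [folklore] -/
theorem glueStep_of_ge (hτ : 0 < τ) (ht : t₀ + 2 * τ / 3 ≤ t) : glueStep τ t₀ t = 0 := by
  refine stepProfile_of_ge ?_
  rw [le_inv_mul_iff₀ hτ]
  linarith

/-- `0 ≤ θ ≤ 1`. [folklore] -/
theorem glueStep_mem_Icc (τ t₀ t : ℝ) : glueStep τ t₀ t ∈ Icc (0 : ℝ) 1 :=
  stepProfile_mem_Icc _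

/-- `θ(1 - θ) = 0` off the open transition interval `(t₀ + τ/3, t₀ + 2τ/3)` (`τ > 0`). [folklore] -/
theorem glueStep_mul_one_sub_eq_zero (hτ : 0 < τ) (ht : t ≤ t₀ + τ / 3 ∨ t₀ + 2 * τ / 3 ≤ t) :
    glueStep τ t₀ t * (1 - glueStep τ t₀ t) = 0 := by
  rcases ht with ht | ht
  · rw [glueStep_of_le hτ ht]; ring
  · rw [glueStep_of_ge hτ ht]; ring

/-- **Chain rule for the steps**: `θ^{(N)}(t) = τ^{-N} η^{(N)}(τ⁻¹(t - t₀))`. [folklore] -/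
theorem iteratedDeriv_glueStep (N : ℕ) (τ t₀ t : ℝ) :
    iteratedDeriv N (glueStep τ t₀) t = τ⁻¹ ^ N * iteratedDeriv N stepProfile (τ⁻¹ * (t - t₀)) := by
  have h2 := congrFun (iteratedDeriv_comp_sub_const (n := N) (f := fun u => stepProfile (τ⁻¹ * u))
    (s := t₀)) t
  have h3 := congrFun (iteratedDeriv_comp_const_mul (n := N) (contDiff_stepProfile (n := N)) τ⁻¹) (t - t₀)
  calc iteratedDeriv N (glueStep τ t₀) t
      = iteratedDeriv N (fun z => (fun u => stepProfile (τ⁻¹ * u)) (z - t₀)) t := rfl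
    _ = iteratedDeriv N (fun u => stepProfile (τ⁻¹ * u)) (t - t₀) := h2
    _ = τ⁻¹ ^ N * iteratedDeriv N stepProfile (τ⁻¹ * (t - t₀)) := h3

/-- `θ'(t) = τ⁻¹ η'(τ⁻¹(t - t₀))`. [folklore] -/
theorem deriv_glueStep (τ t₀ t : ℝ) :
    deriv (glueStep τ t₀) t = τ⁻¹ * deriv stepProfile (τ⁻¹ * (t - t₀)) := by
  simpa using iteratedDeriv_glueStep 1 τ t₀ t

/-- `θ' = 0` off the open transition interval `(t₀ + τ/3, t₀ + 2τ/3)` (`τ > 0`). [folklore] -/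
theorem deriv_glueStep_eq_zero (hτ : 0 < τ) (ht : t ≤ t₀ + τ / 3 ∨ t₀ + 2 * τ / 3 ≤ t) :
    deriv (glueStep τ t₀) t = 0 := by
  rw [deriv_glueStep, deriv_stepProfile_eq_zero, mul_zero]
  rcases ht with ht | ht
  · left
    rw [inv_mul_le_iff₀ hτ]
    linarith
  · right
    rw [le_inv_mul_iff₀ hτ]
    linarith

/-- **The bound (4.3)**: `|θ^{(N)}(t)| ≤ E_N τ^{-N}` for `τ > 0`. [cite: BuckmasterEtAl2018, §4.1 (4.3)] -/
theorem norm_iteratedDeriv_glueStep_le (hτ : 0 < τ) (N : ℕ) (t₀ t : ℝ) :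
    ‖iteratedDeriv N (glueStep τ t₀) t‖ ≤ stepProfileBound N * τ⁻¹ ^ N := by
  rw [iteratedDeriv_glueStep, norm_mul, norm_pow, norm_inv, Real.norm_of_nonneg hτ.le, mul_comm]
  exact mul_le_mul_of_nonneg_right (norm_iteratedDeriv_stepProfile_le N _) (by positivity)

/-- In particular `|θ'(t)| ≤ E₁ τ⁻¹`. [cite: BuckmasterEtAl2018, §4.1 (4.3)] -/
theorem abs_deriv_glueStep_le (hτ : 0 < τ) (t₀ t : ℝ) :
    |deriv (glueStep τ t₀) t| ≤ stepProfileBound 1 * τ⁻¹ := by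
  simpa [iteratedDeriv_one, Real.norm_eq_abs] using norm_iteratedDeriv_glueStep_le hτ 1 t₀ t

/-- `θ` as a `HasDerivAt` statement. [folklore] -/
theorem hasDerivAt_glueStep (τ t₀ t : ℝ) : HasDerivAt (glueStep τ t₀) (deriv (glueStep τ t₀) t) t :=
  ((contDiff_glueStep (n := 1) τ t₀).differentiable one_ne_zero t).hasDerivAt

/-- Consecutive steps are nested: if `θ_{t₀}(t) ≠ 0` then `θ_{t₀ + τ}(t) = 1` (indeed
`t < t₀ + 2τ/3 ≤ (t₀ + τ) + τ/3`), so `θ_{t₀} θ_{t₀+τ} = θ_{t₀}` (`τ > 0`). [folklore] -/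
theorem glueStep_mul_glueStep_add (hτ : 0 < τ) (t₀ t : ℝ) :
    glueStep τ t₀ t * glueStep τ (t₀ + τ) t = glueStep τ t₀ t := by
  rcases le_or_gt (t₀ + 2 * τ / 3) t with ht | ht
  · rw [glueStep_of_ge hτ ht, zero_mul]
  · rw [glueStep_of_le hτ (t₀ := t₀ + τ) (by linarith), mul_one]

/-- Steps are monotone in the anchor: `θ_{t₀}(t) ≤ θ_{t₀ + τ}(t)` (`τ > 0`). [folklore] -/
theorem glueStep_le_glueStep_add (hτ : 0 < τ) (t₀ t : ℝ) :
    glueStep τ t₀ t ≤ glueStep τ (t₀ + τ) t := by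
  rcases le_or_gt (t₀ + 2 * τ / 3) t with ht | ht
  · rw [glueStep_of_ge hτ ht]
    exact (glueStep_mem_Icc τ _ t).1
  · rw [glueStep_of_le hτ (t₀ := t₀ + τ) (by linarith)]
    exact (glueStep_mem_Icc τ _ t).2

end Step

/-! ## The partition of unity `χ₀, …, χₙ` on `[0,T]` (last two cut-offs merged) -/

section Partition

variable {τ : ℝ} {n k : ℕ} {t : ℝ}

/-- The upper step of the `k`-th cut-off when `n + 1` cut-offs are used: `θ_{t_k}`, `t_k = kτ`,
for `k < n`, and the constant `1` for `k ≥ n` (the last cut-off is not stepped down inside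
`[0,T]`). [cite: BuckmasterEtAl2018, §4.1 (4.1)–(4.2)] -/
def upperStep (τ : ℝ) (n k : ℕ) (t : ℝ) : ℝ :=
  if k < n then glueStep τ (k * τ) t else 1

/-- The lower step of the `k`-th cut-off: `0` for `k = 0`, the upper step of `k - 1` otherwise.
[cite: BuckmasterEtAl2018, §4.1 (4.1)–(4.2)] -/
def lowerStep (τ : ℝ) (n : ℕ) : ℕ → ℝ → ℝ
  | 0 => fun _ => 0
  | k + 1 => upperStep τ n k

/-- **The time cut-offs** `χ_k = upperStep k - lowerStep k`, `k = 0, …, n`: `χ₀ = θ_{t₀}`,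
`χ_k = θ_{t_k} - θ_{t_{k-1}}` for `1 ≤ k < n`, `χₙ = 1 - θ_{tₙ₋₁}` (`n ≥ 1`; `χ₀ = 1` if `n = 0`),
with `t_k = kτ`: a partition of unity on `ℝ` with `χ_k = 1` on `[t_k - τ/3, t_k + τ/3]`,
`supp χ_k ⊂ (t_k - 2τ/3, t_k + 2τ/3)` for `1 ≤ k < n`, and `‖χ_k^{(N)}‖₀ ≤ 2E_N τ^{-N}`
(BDSV §4.1, (4.1)–(4.3), with the last two cut-offs merged so that only anchors `t_k`, `k ≤ n`,
occur). [cite: BuckmasterEtAl2018, §4.1 (4.1)–(4.3)] -/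
def glueCutoff (τ : ℝ) (n k : ℕ) (t : ℝ) : ℝ :=
  upperStep τ n k t - lowerStep τ n k t

/-- `lowerStep (k+1) = upperStep k`. [folklore] -/
@[simp]
theorem lowerStep_succ (τ : ℝ) (n k : ℕ) : lowerStep τ n (k + 1) = upperStep τ n k := rfl

/-- `lowerStep 0 = 0`. [folklore] -/
@[simp]
theorem lowerStep_zero (τ : ℝ) (n : ℕ) (t : ℝ) : lowerStep τ n 0 t = 0 := rfl

/-- `upperStep k = θ_{kτ}` for `k < n`. [folklore] -/
theorem upperStep_of_lt (hk : k < n) (τ t : ℝ) : upperStep τ n k t = glueStep τ (k * τ) t := by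
  simp [upperStep, hk]

/-- `upperStep k = 1` for `n ≤ k`. [folklore] -/
theorem upperStep_of_le (hk : n ≤ k) (τ t : ℝ) : upperStep τ n k t = 1 := by
  simp [upperStep, not_lt.2 hk]

/-- The upper steps are smooth. [folklore] -/
theorem contDiff_upperStep {m : ℕ∞} (τ : ℝ) (n k : ℕ) : ContDiff ℝ m (upperStep τ n k) := by
  by_cases hk : k < n
  · have e : upperStep τ n k = glueStep τ (k * τ) := funext fun s => upperStep_of_lt hk τ s
    rw [e]
    exact contDiff_glueStep τ _
  · have e : upperStep τ n k = fun _ => (1 : ℝ) := funext fun s => upperStep_of_le (not_lt.1 hk) τ s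
    rw [e]
    exact contDiff_const

/-- The lower steps are smooth. [folklore] -/
theorem contDiff_lowerStep {m : ℕ∞} (τ : ℝ) (n k : ℕ) : ContDiff ℝ m (lowerStep τ n k) := by
  cases k with
  | zero => exact contDiff_const
  | succ k => exact contDiff_upperStep τ n k

/-- The cut-offs are smooth. [folklore] -/
theorem contDiff_glueCutoff {m : ℕ∞} (τ : ℝ) (n k : ℕ) : ContDiff ℝ m (glueCutoff τ n k) :=
  (contDiff_upperStep τ n k).sub (contDiff_lowerStep τ n k)

/-- `0 ≤ upperStep ≤ 1`. [folklore] -/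
theorem upperStep_mem_Icc (τ : ℝ) (n k : ℕ) (t : ℝ) : upperStep τ n k t ∈ Icc (0 : ℝ) 1 := by
  by_cases hk : k < n
  · rw [upperStep_of_lt hk]; exact glueStep_mem_Icc τ _ t
  · rw [upperStep_of_le (not_lt.1 hk)]; exact ⟨zero_le_one, le_rfl⟩

/-- The upper steps increase with `k`: `lowerStep k ≤ upperStep k` (`τ > 0`). [folklore] -/
theorem lowerStep_le_upperStep (hτ : 0 < τ) (n k : ℕ) (t : ℝ) : lowerStep τ n k t ≤ upperStep τ n k t := by
  cases k with
  | zero => exact (upperStep_mem_Icc τ n 0 t).1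
  | succ k =>
    rw [lowerStep_succ]
    by_cases hk : k + 1 < n
    · rw [upperStep_of_lt hk, upperStep_of_lt (k.lt_succ_self.trans hk)]
      have h := glueStep_le_glueStep_add hτ (k * τ) t
      have e : (k : ℝ) * τ + τ = ((k + 1 : ℕ) : ℝ) * τ := by push_cast; ring
      rwa [e] at h
    · rw [upperStep_of_le (not_lt.1 hk)]
      exact (upperStep_mem_Icc τ n k t).2

/-- `0 ≤ χ_k ≤ 1` (`τ > 0`). [folklore] -/
theorem glueCutoff_mem_Icc (hτ : 0 < τ) (n k : ℕ) (t : ℝ) : glueCutoff τ n k t ∈ Icc (0 : ℝ) 1 := by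
  refine ⟨sub_nonneg.2 (lowerStep_le_upperStep hτ n k t), ?_⟩
  have h0 : 0 ≤ lowerStep τ n k t := by
    cases k with
    | zero => exact le_rfl
    | succ k => exact (upperStep_mem_Icc τ n k t).1
  have h1 := (upperStep_mem_Icc τ n k t).2
  unfold glueCutoff
  linarith

/-- **Partition of unity**: `∑_{k ≤ n} χ_k ≡ 1` (telescoping). [cite: BuckmasterEtAl2018, §4.1 (4.1)] -/
theorem sum_glueCutoff (τ : ℝ) (n : ℕ) (t : ℝ) :
    ∑ k ∈ Finset.range (n + 1), glueCutoff τ n k t = 1 := by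
  have h : ∀ k, glueCutoff τ n k t = lowerStep τ n (k + 1) t - lowerStep τ n k t := fun k => rfl
  simp_rw [h]
  rw [Finset.sum_range_sub (fun k => lowerStep τ n k t), lowerStep_succ, upperStep_of_le le_rfl,
    lowerStep_zero, sub_zero]

/-- **Plateau**: `χ_k = 1` on `[t_k - τ/3, t_k + τ/3]` (for `k = n`: on `[tₙ - τ/3, ∞)`; for
`k = 0`: on `(-∞, τ/3]`), `τ > 0`. [cite: BuckmasterEtAl2018, §4.1 (4.2)] -/
theorem glueCutoff_eq_one (hτ : 0 < τ) (hk : k ≤ n) (h1 : k = 0 ∨ (k : ℝ) * τ - τ / 3 ≤ t)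
    (h2 : k = n ∨ t ≤ (k : ℝ) * τ + τ / 3) : glueCutoff τ n k t = 1 := by
  have hup : upperStep τ n k t = 1 := by
    rcases h2 with rfl | h2
    · exact upperStep_of_le le_rfl τ t
    · rcases lt_or_eq_of_le hk with hk' | rfl
      · rw [upperStep_of_lt hk']; exact glueStep_of_le hτ h2
      · exact upperStep_of_le le_rfl τ t
  have hlow : lowerStep τ n k t = 0 := by
    cases k with
    | zero => rfl
    | succ k =>
      rcases h1 with h | h1
      · exact absurd h (Nat.succ_ne_zero k)
      rw [lowerStep_succ, upperStep_of_lt (Nat.lt_of_succ_le hk)]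
      refine glueStep_of_ge hτ ?_
      push_cast at h1
      linarith
  rw [glueCutoff, hup, hlow, sub_zero]

/-- **Support, left**: `χ_k = 0` for `t ≤ t_k - 2τ/3` when `1 ≤ k ≤ n` (both steps equal `1`),
`τ > 0`. [cite: BuckmasterEtAl2018, §4.1 (4.2)] -/
theorem glueCutoff_eq_zero_of_le (hτ : 0 < τ) (hk1 : 1 ≤ k) (ht : t ≤ (k : ℝ) * τ - 2 * τ / 3) :
    glueCutoff τ n k t = 0 := by
  obtain ⟨j, rfl⟩ := Nat.exists_eq_add_of_le' hk1
  have hlow : lowerStep τ n (j + 1) t = 1 := by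
    rw [lowerStep_succ]
    by_cases hj : j < n
    · rw [upperStep_of_lt hj]
      refine glueStep_of_le hτ ?_
      push_cast at ht
      linarith
    · exact upperStep_of_le (not_lt.1 hj) τ t
  have hup : upperStep τ n (j + 1) t = 1 := by
    by_cases hj : j + 1 < n
    · rw [upperStep_of_lt hj]
      refine glueStep_of_le hτ ?_
      linarith
    · exact upperStep_of_le (not_lt.1 hj) τ t
  rw [glueCutoff, hup, hlow, sub_self]

/-- **Support, right**: `χ_k = 0` for `t ≥ t_k + 2τ/3` when `k < n` (both steps vanish),
`τ > 0`. [cite: BuckmasterEtAl2018, §4.1 (4.2)] -/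
theorem glueCutoff_eq_zero_of_ge (hτ : 0 < τ) (hk : k < n) (ht : (k : ℝ) * τ + 2 * τ / 3 ≤ t) :
    glueCutoff τ n k t = 0 := by
  have hup : upperStep τ n k t = 0 := by
    rw [upperStep_of_lt hk]; exact glueStep_of_ge hτ ht
  have hlow : lowerStep τ n k t = 0 := by
    cases k with
    | zero => rfl
    | succ k =>
      rw [lowerStep_succ, upperStep_of_lt (k.lt_succ_self.trans hk)]
      refine glueStep_of_ge hτ ?_
      push_cast at ht
      linarith
  rw [glueCutoff, hup, hlow, sub_self]

/-- **Transition region**: on `Iₖ = [t_k + τ/3, t_k + 2τ/3]`, `k < n`, the `k`-th cut-off is the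
step `θ_{t_k}`. [cite: BuckmasterEtAl2018, §4.1 ("if `t ∈ Iᵢ`, then `χᵢ + χᵢ₊₁ = 1`")] -/
theorem glueCutoff_eq_glueStep (hτ : 0 < τ) (hk : k < n) (ht : (k : ℝ) * τ - τ / 3 ≤ t) :
    glueCutoff τ n k t = glueStep τ (k * τ) t := by
  have hlow : lowerStep τ n k t = 0 := by
    cases k with
    | zero => rfl
    | succ k =>
      rw [lowerStep_succ, upperStep_of_lt (k.lt_succ_self.trans hk)]
      refine glueStep_of_ge hτ ?_
      push_cast at ht
      linarith
  rw [glueCutoff, upperStep_of_lt hk, hlow, sub_zero]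

/-- **Transition region**: on `Iₖ`, `k < n`, the `(k+1)`-st cut-off is `1 - θ_{t_k}`.
[cite: BuckmasterEtAl2018, §4.1 ("if `t ∈ Iᵢ`, then `χᵢ + χᵢ₊₁ = 1`")] -/
theorem glueCutoff_succ_eq_one_sub_glueStep (hτ : 0 < τ) (hk : k < n) (ht : t ≤ (k : ℝ) * τ + τ + τ / 3) :
    glueCutoff τ n (k + 1) t = 1 - glueStep τ (k * τ) t := by
  have hup : upperStep τ n (k + 1) t = 1 := by
    by_cases hk1 : k + 1 < n
    · rw [upperStep_of_lt hk1]
      refine glueStep_of_le hτ ?_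
      push_cast
      linarith
    · exact upperStep_of_le (not_lt.1 hk1) τ t
  rw [glueCutoff, hup, lowerStep_succ, upperStep_of_lt hk]

/-- **Derivative bounds (4.3)** for the cut-offs: `|χ_k^{(N)}(t)| ≤ 2 E_N τ^{-N}`, `τ > 0`.
[cite: BuckmasterEtAl2018, §4.1 (4.3)] -/
theorem norm_iteratedDeriv_glueCutoff_le (hτ : 0 < τ) (N : ℕ) (n k : ℕ) (t : ℝ) :
    ‖iteratedDeriv N (glueCutoff τ n k) t‖ ≤ 2 * (max (stepProfileBound N) 1 * τ⁻¹ ^ N) := by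
  have hB : 0 ≤ max (stepProfileBound N) 1 * τ⁻¹ ^ N := by positivity
  -- a bound for every upper step (steps, or the constant `1`)
  have hup : ∀ j, ‖iteratedDeriv N (upperStep τ n j) t‖ ≤ max (stepProfileBound N) 1 * τ⁻¹ ^ N := by
    intro j
    by_cases hj : j < n
    · have e : upperStep τ n j = glueStep τ (j * τ) := funext fun s => upperStep_of_lt hj τ s
      rw [e]
      exact (norm_iteratedDeriv_glueStep_le hτ N _ t).trans
        (mul_le_mul_of_nonneg_right (le_max_left _ _) (by positivity))
    · have e : upperStep τ n j = fun _ => (1 : ℝ) := funext fun s => upperStep_of_le (not_lt.1 hj) τ s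
      rw [e, iteratedDeriv_const]
      split_ifs with hN
      · subst hN
        simp
      · rw [norm_zero]
        exact hB
  have hlow : ‖iteratedDeriv N (lowerStep τ n k) t‖ ≤ max (stepProfileBound N) 1 * τ⁻¹ ^ N := by
    cases k with
    | zero =>
      change ‖iteratedDeriv N (fun _ : ℝ => (0 : ℝ)) t‖ ≤ _
      rw [iteratedDeriv_fun_const_zero, norm_zero]
      exact hB
    | succ k => exact hup k
  have hsub : iteratedDeriv N (glueCutoff τ n k) t =
      iteratedDeriv N (upperStep τ n k) t - iteratedDeriv N (lowerStep τ n k) t := by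
    have e : glueCutoff τ n k = upperStep τ n k - lowerStep τ n k := rfl
    rw [e, iteratedDeriv_sub ((contDiff_upperStep τ n k).contDiffAt) ((contDiff_lowerStep τ n k).contDiffAt)]
  rw [hsub]
  calc ‖iteratedDeriv N (upperStep τ n k) t - iteratedDeriv N (lowerStep τ n k) t‖
      ≤ ‖iteratedDeriv N (upperStep τ n k) t‖ + ‖iteratedDeriv N (lowerStep τ n k) t‖ := norm_sub_le _ _
    _ ≤ _ := by linarith [hup k, hlow]

end Partition

end BDSV

end Literature.Analysis.FluidPDE
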